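import Mathlib
import Summits.SmoothPoincare4.SmoothPoincare4.Theses.CylinderEntropy
import Summits.SmoothPoincare4.SmoothPoincare4.Cruxes.ThinCrossSectionExists.Disproof
import Literature.Geometry.Riemannian.SphericalCylinderEntropy

/-!
# Sketch (crux-ideate round 2, ideator 6) — card `rigid-rung-circle-cancellation`

First lemmas of the line, typed over existing declarations (nothing here is registered as a stub):

* (A) `HarnackStrict` — analytic rigidity AT the threshold: Hamilton's matrix Harnack form of the zonal
  heat kernel of `S⁴` is strictly positive (numerics: `numerics/harnack_check.py`, min normalised eigenvalue
  `≈ τ` on the diagonal, `→ 1` as `τ → ∞`), so Hamilton's monotonicity in `N = S⁴×ℝ` is STRICT for every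
  flow and the recognition rung may use the NON-STRICT threshold `λ_cyl ≤ 4/e`.
* (B) `GeneratorCircleUnknots` — topological rigidity of index-1 surgery: an embedded circle in `S¹×S³`
  homotopic to the core is carried to the core by a diffeomorphism (homotopy ⇒ isotopy for circles in a
  4-manifold); it is the load-bearing input of the cancellation lemma `Σ # k(S¹×S³) ≅ #k(S¹×S³) ⇒ Σ ≅ S⁴`.
* (C) the logical skeleton over a POSITED relational predicate `IsCircleSumSphere X k M`
  ("`M ≅ X # k(S¹×S³)`", definition request D1): `Cancel`, `RNatLe` (recognition without `π₁ = 1` and with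
  `≤`), `ENatLe` (the crux freed of `π₁ = 1` and of strictness) and the kernel-checked composition
  `crux_of_rigidRung : Cancel → RNatLe → ENatLe → SliceCalibration → ThinCrossSectionExists`, plus
  `eNatLe_of_crux` (E ⇒ E♮_≤ : the transfer is to a WEAKER statement) and `rungTwo_of_rNatLe`.
-/

noncomputable section

open scoped Manifold ContDiff ENNReal Topology ContinuousMap

set_option linter.dupNamespace false
open Set
open Literature.Geometry.Riemannian.SphericalCylinderEntropy (zonal cylEntropy)
open Summit.SmoothPoincare4.SmoothPoincare4.Theses.CylinderEntropy (ThinCrossSectionExists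
  CylinderRungTwo SliceCalibration)
open Summit.SmoothPoincare4.SmoothPoincare4.Cruxes.ThinCrossSectionExists.Disproof (CrossSectionBelow
  ThinAtLevel level InN Separates crux_iff crossSectionBelow_of_diffeomorph thinAtLevel_mono)

namespace Summit.SmoothPoincare4.SmoothPoincare4.Cruxes.ThinCrossSectionExists.RigidRung

local notation "E⁶" => EuclideanSpace ℝ (Fin 6)
local notation "E⁴" => EuclideanSpace ℝ (Fin 4)
local notation "𝕊⁴" => (Metric.sphere (0 : EuclideanSpace ℝ (Fin 5)) 1)
local notation "𝕊³" => (Metric.sphere (0 : EuclideanSpace ℝ (Fin 4)) 1)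
local notation "𝕊¹" => (Metric.sphere (0 : EuclideanSpace ℝ (Fin 2)) 1)

/-! ## (A) Strict Hamilton–Harnack for the `S⁴` kernel (first lemma, analytic side) -/

/-- **FIRST LEMMA (A)** `HarnackStrict`: for `f(θ) = log 𝔥(τ, cos θ)` (tree `zonal` = `vol(S⁴)·H_{S⁴}` as the
typed Gegenbauer series) both eigenvalues of `Hess log H_{S⁴} + g/(2τ)` — the radial one `f'' + 1/(2τ)` and
the tangential one `cot θ · f' + 1/(2τ)` — are STRICTLY positive for all `τ > 0`, `θ ∈ (0, π)`.
(Hamilton 1993 gives `≥ 0` on manifolds with `sec ≥ 0` and parallel Ricci; the Euclidean kernel gives `= 0`;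
on `S⁴` the normalised minimum is `≈ τ` for small `τ`, numerically.)  Consequence: along any mean curvature
flow of hypersurfaces of `N = S⁴×ℝ`, `t ↦ F̂_{p,t₀−t}(M_t)` is strictly decreasing, so a singularity of
Gaussian density `Θ` at `(p, t₀)` forces `Θ < F̂_{p,t₀}(M₀) ≤ λ_cyl(M₀)`: a compact cross-section with
`λ_cyl ≤ 4/e` (non-strict) still has no bubble-sheet singularity. -/
def HarnackStrict : Prop :=
  ∀ τ θ : ℝ, 0 < τ → 0 < θ → θ < Real.pi →
    0 < deriv (deriv fun t : ℝ => Real.log (zonal τ (Real.cos t))) θ + 1 / (2 * τ) ∧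
    0 < Real.cos θ / Real.sin θ * deriv (fun t : ℝ => Real.log (zonal τ (Real.cos t))) θ + 1 / (2 * τ)

/-! ## (B) Index-1 surgery is rigid: generator circles unknot in `S¹ × S³` (first lemma, topological side) -/

/-- The core circle `θ ↦ (θ, p₀)` of `S¹ × S³`. -/
def coreCircle (p₀ : 𝕊³) : C(𝕊¹, 𝕊¹ × 𝕊³) :=
  ⟨fun θ => (θ, p₀), by fun_prop⟩

/-- **FIRST LEMMA (B)** `GeneratorCircleUnknots`: a smoothly embedded circle in `S¹×S³` that is homotopic to
the core circle is carried onto the core (up to reparametrisation) by a self-diffeomorphism of `S¹×S³`.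
Classical (general position: homotopic embedded circles in a 4-manifold are isotopic; isotopy extension);
it is exactly what makes surgery on a generator of `π₁(Σ # (S¹×S³)) = ℤ` well defined, whence
`Σ # (S¹×S³) ≅ S¹×S³ ⇒ Σ ≅ S⁴` (surgery on the core of `S¹×S³` gives `S⁴`; on the core of the summand it
gives back `Σ`). -/
def GeneratorCircleUnknots : Prop :=
  ∀ (p₀ : 𝕊³) (c : C(𝕊¹, 𝕊¹ × 𝕊³)),
    Manifold.IsSmoothEmbedding (𝓡 1) ((𝓡 1).prod (𝓡 3)) ∞ (c : 𝕊¹ → 𝕊¹ × 𝕊³) →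
    c.Homotopic (coreCircle p₀) →
    ∃ (Φ : (𝕊¹ × 𝕊³) ≃ₘ⟮(𝓡 1).prod (𝓡 3), (𝓡 1).prod (𝓡 3)⟯ (𝕊¹ × 𝕊³))
      (ψ : 𝕊¹ ≃ₘ⟮𝓡 1, 𝓡 1⟯ 𝕊¹), ∀ θ : 𝕊¹, Φ (c θ) = (ψ θ, p₀)

/-! ## (C) The logical skeleton over a posited relational predicate

`IsCircleSumSphere X k M` is to mean "`M` is diffeomorphic to `X # k(S¹×S³)`" (definition request D1: a
relational gluing predicate like the tree's `IsGluckTwist` / `IsIntegralSurgery`).  It is a VARIABLE here: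
nothing about it is assumed except where a lemma says so explicitly. -/

variable (IsCircleSumSphere :
  ∀ (X : Type) [TopologicalSpace X] [ChartedSpace E⁴ X] (k : ℕ) (M : Type) [TopologicalSpace M]
    [ChartedSpace E⁴ M], Prop)

/-- **Cancel** (the cancellation lemma, paper-provable from (B) + Nielsen ⇒ Andrews–Curtis-trivial ⇒
`H⁵(P) ≅ B⁵`; for `k = 1` from (B) alone): if a homotopy 4-sphere `X` and the standard `S⁴` have a common
`S¹×S³`-stabilisation `M` (numbers of summands a priori different; they agree by `H₁`), then `X ≅ S⁴`. -/
def Cancel : Prop :=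
  ∀ (X : Type) [TopologicalSpace X] [T2Space X] [SecondCountableTopology X] [ChartedSpace E⁴ X]
    [IsManifold (𝓡 4) ∞ X], X ≃ₕ 𝕊⁴ →
    ∀ (k k' : ℕ) (M : Type) [TopologicalSpace M] [T2Space M] [SecondCountableTopology M]
      [ChartedSpace E⁴ M] [IsManifold (𝓡 4) ∞ M],
      IsCircleSumSphere X k M → IsCircleSumSphere 𝕊⁴ k' M → Nonempty (X ≃ₘ⟮𝓡 4, 𝓡 4⟯ 𝕊⁴)

/-- **R♮_≤** (recognition WITHOUT `π₁ = 1` and WITH the non-strict threshold): every compact end-separating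
smooth cross-section of `N` with `λ_cyl ≤ 4/e` is an `S¹×S³`-stabilisation of `S⁴`.  This is what the
route's engine (Hamilton monotonicity — strict by (A) — + the Chodosh–Mantoulidis–Schulze transplant:
only necks and round points) natively outputs, BEFORE `π₁ = 1` is used to kill the summands. -/
def RNatLe : Prop :=
  ∀ (M : Type) [TopologicalSpace M] [T2Space M] [SecondCountableTopology M] [CompactSpace M]
    [ChartedSpace E⁴ M] [IsManifold (𝓡 4) ∞ M] (ι : M → E⁶),
    Manifold.IsSmoothEmbedding (𝓡 4) (𝓡 6) ∞ ι → (∀ x, InN (ι x)) → Separates (Set.range ι) →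
    cylEntropy (Set.range ι) ≤ level → ∃ k : ℕ, IsCircleSumSphere 𝕊⁴ k M

/-- **E♮_≤** (the crux freed of `π₁ = 1` and of strictness): every homotopy 4-sphere `X` has, for some `k`,
an `S¹×S³`-stabilisation `M ≅ X # k(S¹×S³)` with a compact end-separating smooth cross-section embedding
of cylinder entropy `≤ 4/e`. -/
def ENatLe : Prop :=
  ∀ (X : Type) [TopologicalSpace X] [T2Space X] [SecondCountableTopology X] [ChartedSpace E⁴ X]
    [IsManifold (𝓡 4) ∞ X], X ≃ₕ 𝕊⁴ →
    ∃ (k : ℕ) (M : Type) (_ : TopologicalSpace M) (_ : T2Space M) (_ : SecondCountableTopology M)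
      (_ : CompactSpace M) (_ : ChartedSpace E⁴ M) (_ : IsManifold (𝓡 4) ∞ M),
      IsCircleSumSphere X k M ∧ ∃ ι : M → E⁶, Manifold.IsSmoothEmbedding (𝓡 4) (𝓡 6) ∞ ι ∧
        (∀ x, InN (ι x)) ∧ Separates (Set.range ι) ∧ cylEntropy (Set.range ι) ≤ level

/-- **The composition** (kernel-checked): Cancel → R♮_≤ → E♮_≤ → SliceCalibration → E.
From E♮_≤ take the thin stabilised cross-section `M`; R♮_≤ recognises it as a stabilisation of `S⁴`;
Cancel gives `X ≅ S⁴`; the slice through that diffeomorphism is the thin cross-section of `X`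
(`crossSectionBelow_of_diffeomorph`, which uses `SliceCalibration`). -/
theorem crux_of_rigidRung (hC : Cancel IsCircleSumSphere) (hR : RNatLe IsCircleSumSphere)
    (hE : ENatLe IsCircleSumSphere) (hcal : SliceCalibration) : ThinCrossSectionExists := by
  rw [crux_iff]
  intro X _ _ _ _ _ e
  obtain ⟨k, M, _, _, _, _, _, _, hsum, ι, hι, hN, hsep, hle⟩ := hE X e
  obtain ⟨k', hsum'⟩ := hR M ι hι hN hsep hle
  obtain ⟨φ⟩ := hC X e k k' M hsum hsum'
  exact crossSectionBelow_of_diffeomorph hcal φ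

/-- **E ⇒ E♮_≤** given only that "`X` is its own `0`-fold stabilisation": the transfer is to a WEAKER
statement (the crux with strict `<` and `k = 0` is a special case). -/
theorem eNatLe_of_crux
    (zero_self : ∀ (X : Type) [TopologicalSpace X] [ChartedSpace E⁴ X], IsCircleSumSphere X 0 X)
    (h : ThinCrossSectionExists) : ENatLe IsCircleSumSphere := by
  rw [crux_iff] at h
  intro X _ _ _ _ _ e
  obtain ⟨ι, hι, hN, hsep, hlt⟩ := h X e
  haveI : CompactSpace X :=
    Summit.SmoothPoincare4.SmoothPoincare4.Cruxes.ThinCrossSectionExists.Disproof.compactSpace_of_homotopyEquiv_noSC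
      X e
  exact ⟨0, X, inferInstance, inferInstance, inferInstance, inferInstance, inferInstance, inferInstance,
    zero_self X, ι, hι, hN, hsep, hlt.le⟩

/-- **R♮_≤ ⇒ R** (= `CylinderRungTwo`) given only that "a simply-connected stabilisation of `S⁴` is `S⁴`"
(`IsCircleSumSphere S⁴ k M` with `M ≃ₕ S⁴` forces `k = 0` by `H₁`, and `k = 0` means `M ≅ S⁴`). -/
theorem rungTwo_of_rNatLe
    (sphere_sum_of_homotopySphere : ∀ (k : ℕ) (M : Type) [TopologicalSpace M] [T2Space M]
      [SecondCountableTopology M] [ChartedSpace E⁴ M] [IsManifold (𝓡 4) ∞ M],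
      M ≃ₕ 𝕊⁴ → IsCircleSumSphere 𝕊⁴ k M → Nonempty (M ≃ₘ⟮𝓡 4, 𝓡 4⟯ 𝕊⁴))
    (hR : RNatLe IsCircleSumSphere) : CylinderRungTwo := by
  intro M _ _ _ _ _ e ι hι hN hsep hlt
  haveI : CompactSpace M :=
    Summit.SmoothPoincare4.SmoothPoincare4.Cruxes.ThinCrossSectionExists.Disproof.compactSpace_of_homotopyEquiv_noSC
      M e
  obtain ⟨R, hR'⟩ := hsep
  obtain ⟨k, hk⟩ := hR M ι hι (fun x => hN x) ⟨R, hR'⟩ (le_of_lt hlt)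
  exact sphere_sum_of_homotopySphere k M e hk

/-- Sanity: `E♮_≤ ∧ R♮_≤ ∧ Cancel` decide the summit exactly like `E ∧ R` (the route's `closes`), so the
transfer loses nothing for the route. -/
theorem spc4_of_rigidRung (hC : Cancel IsCircleSumSphere) (hR : RNatLe IsCircleSumSphere)
    (hE : ENatLe IsCircleSumSphere) (hcal : SliceCalibration)
    (sphere_sum_of_homotopySphere : ∀ (k : ℕ) (M : Type) [TopologicalSpace M] [T2Space M]
      [SecondCountableTopology M] [ChartedSpace E⁴ M] [IsManifold (𝓡 4) ∞ M],
      M ≃ₕ 𝕊⁴ → IsCircleSumSphere 𝕊⁴ k M → Nonempty (M ≃ₘ⟮𝓡 4, 𝓡 4⟯ 𝕊⁴)) :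
    _root_.SmoothPoincare4 :=
  Summit.SmoothPoincare4.SmoothPoincare4.Theses.CylinderEntropy.closes
    (rungTwo_of_rNatLe IsCircleSumSphere sphere_sum_of_homotopySphere hR)
    (crux_of_rigidRung IsCircleSumSphere hC hR hE hcal)

/-- The crux is literally `ThinAtLevel level` (check that we are talking about the route's functional). -/
example : ThinCrossSectionExists ↔ ThinAtLevel level := Iff.rfl

end Summit.SmoothPoincare4.SmoothPoincare4.Cruxes.ThinCrossSectionExists.RigidRung

end
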